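import Summits.AtomisticToContinuum.HydrodynamicLimit.Theorems.JParityClosureLocalSecondLawLedgerKernel
import Summits.AtomisticToContinuum.HydrodynamicLimit.Theorems.JParityClosureLocalSecondLawLedgerCalculus
import Mathlib.Analysis.SpecialFunctions.SmoothTransition

/-!
# Entropy ledger for `JParityClosure.LocalSecondLaw` — a smooth global modification of the entropy density
(stmt-AtomisticToContinuum-13081, line `exact-entropy-ledger-three-passivities`, layer 7 of stub L)

The weak balance law along a hard-sphere trajectory (`sub_eq_integral_add_finsum_collisionJump_td`) is
stated for observables that stream differentiably along EVERY free flight.  The guarded entropy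
`H(ρ, θ)` is only smooth on the regular range, so we replace it by a globally `C¹` function `Ĥ` of the
conserved variables `(ρ, m, e)` which agrees with `H(ρ, θ(ρ, m, e))` on an open neighbourhood of the regular
range `{ρ ≥ c, θ ≥ c, ρσ³ ≤ η₁}`: the arguments of `log`, of `1/ρ` and of the excess free energy are passed
through smooth soft clamps built from `Real.smoothTransition` (`softMax a δ y = y` for `y ≥ a + δ`,
`softMax a δ y ≥ a`).  Along the regular orbit nothing changes; off it the values of `Ĥ` are irrelevant.

References: L. Hörmander, *The Analysis of Linear Partial Differential Operators I* (1990) §1.4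
(smooth cut-offs).
-/

noncomputable section

namespace Summit.AtomisticToContinuum.HydrodynamicLimit.Theorems.LocalSecondLawLedger

open scoped BigOperators Topology
open Filter Set
open Literature.Analysis.FunctionSpaces
open Literature.MathematicalPhysics.KineticTheory
open Summit.AtomisticToContinuum.HydrodynamicLimit.Theorems.LocalSecondLawNegative

namespace L

/-! ## Smooth soft clamps -/

/-- The smooth soft clamp from below: `softMax a δ y = a + (y - a) χ((y - a)/δ)` with Mathlib's smooth
transition `χ`; equals `y` for `y ≥ a + δ`, is `≥ a` everywhere and `≤ max a y`. [folklore] -/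
def softMax (a δ y : ℝ) : ℝ := a + (y - a) * Real.smoothTransition ((y - a) / δ)

/-- The soft clamp is smooth. [folklore] -/
theorem contDiff_softMax (a δ : ℝ) {n : ℕ∞} : ContDiff ℝ n (softMax a δ) := by
  unfold softMax
  exact contDiff_const.add ((contDiff_id.sub contDiff_const).mul
    (Real.smoothTransition.contDiff.comp ((contDiff_id.sub contDiff_const).div_const δ)))

/-- Above `a + δ` the soft clamp is the identity. [folklore] -/
theorem softMax_eq_self {a δ y : ℝ} (hδ : 0 < δ) (h : a + δ ≤ y) : softMax a δ y = y := by
  unfold softMax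
  rw [Real.smoothTransition.one_of_one_le, mul_one, add_sub_cancel]
  rw [le_div_iff₀ hδ]; linarith

/-- The soft clamp is bounded below by the floor. [folklore] -/
theorem le_softMax (a δ y : ℝ) (hδ : 0 < δ) : a ≤ softMax a δ y := by
  unfold softMax
  rcases le_or_gt a y with h | h
  · have : 0 ≤ (y - a) * Real.smoothTransition ((y - a) / δ) :=
      mul_nonneg (by linarith) (Real.smoothTransition.nonneg _)
    linarith
  · rw [Real.smoothTransition.zero_of_nonpos (by rw [div_nonpos_iff]; right; constructor <;> linarith)]
    simp

/-- The soft clamp is bounded above by `max a y`. [folklore] -/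
theorem softMax_le (a δ y : ℝ) (hδ : 0 < δ) : softMax a δ y ≤ max a y := by
  unfold softMax
  rcases le_or_gt a y with h | h
  · have : (y - a) * Real.smoothTransition ((y - a) / δ) ≤ (y - a) * 1 :=
      mul_le_mul_of_nonneg_left (Real.smoothTransition.le_one _) (by linarith)
    rw [max_eq_right h]; linarith
  · rw [Real.smoothTransition.zero_of_nonpos (by rw [div_nonpos_iff]; right; constructor <;> linarith)]
    simp

/-! ## The modified entropy density -/

/-- The phase space of the conserved variables `(ρ, m, e)`. -/
abbrev CV : Type := ℝ × (Fin 3 → ℝ) × ℝ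

/-- The temperature `θ(ρ, m, e) = (2/3)(e/ρ - |m|²/(2ρ²))` as a function of the conserved variables. [folklore] -/
def thetaOf (ρ e : ℝ) (m : Fin 3 → ℝ) : ℝ := 2 / 3 * (e / ρ - (∑ k, m k ^ 2) / (2 * ρ ^ 2))

/-- **The modified entropy density** `Ĥ(ρ, m, e)`: the smooth branch of `H` with its density argument softly
clamped to `≥ c/4` (identity above `c/2`), its temperature softly clamped to `≥ c/4` (identity above `c/2`)
and its equation-of-state argument softly clamped to `≤ (η₁+η₀)/2` (identity below `(2η₁+η₀)/3`). [folklore] -/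
def Hhat (σ c η₀ η₁ : ℝ) (p : CV) : ℝ :=
  -(softMax (c / 4) (c / 4) p.1 *
    (3 / 2 * Real.log (softMax (c / 4) (c / 4) (thetaOf (softMax (c / 4) (c / 4) p.1) p.2.2 p.2.1))
      - Real.log (softMax (c / 4) (c / 4) p.1)
      - hsExcessFreeEnergy ((η₁ + η₀) / 2
          - softMax 0 ((η₀ - η₁) / 6) ((η₁ + η₀) / 2 - softMax (c / 4) (c / 4) p.1 * σ ^ 3))))

/-- The open neighbourhood of the regular range on which `Ĥ` is the smooth branch of `H`. -/
def regNbhd (σ c η₀ η₁ : ℝ) : Set CV :=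
  {p | c / 2 < p.1 ∧ c / 2 < thetaOf p.1 p.2.2 p.2.1 ∧ p.1 * σ ^ 3 < (2 * η₁ + η₀) / 3}

section Props

variable {σ c η₀ η₁ : ℝ} {F : ℝ → ℝ} (hE : EosBand η₀ F) (hη : 0 < η₁) (hη₁ : η₁ < η₀) (hσ : 0 < σ) (hc : 0 < c)

include hc in
/-- The clamped density is positive. [folklore] -/
theorem softMax_density_pos (y : ℝ) : 0 < softMax (c / 4) (c / 4) y :=
  lt_of_lt_of_le (by positivity) (le_softMax _ _ _ (by positivity))

include hη hη₁ hσ hc in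
/-- The clamped equation-of-state argument lies inside the band. [folklore] -/
theorem clampedEos_mem (y : ℝ) :
    (η₁ + η₀) / 2 - softMax 0 ((η₀ - η₁) / 6) ((η₁ + η₀) / 2 - softMax (c / 4) (c / 4) y * σ ^ 3)
      ∈ Set.Ioo 0 η₀ := by
  have hδ : 0 < (η₀ - η₁) / 6 := by linarith
  have h1 := le_softMax 0 ((η₀ - η₁) / 6) ((η₁ + η₀) / 2 - softMax (c / 4) (c / 4) y * σ ^ 3) hδ
  have h2 := softMax_le 0 ((η₀ - η₁) / 6) ((η₁ + η₀) / 2 - softMax (c / 4) (c / 4) y * σ ^ 3) hδ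
  have h3 : 0 < softMax (c / 4) (c / 4) y * σ ^ 3 := mul_pos (softMax_density_pos hc y) (by positivity)
  constructor
  · have : max 0 ((η₁ + η₀) / 2 - softMax (c / 4) (c / 4) y * σ ^ 3) < (η₁ + η₀) / 2 := by
      rw [max_lt_iff]; constructor <;> linarith
    linarith
  · linarith

include hE hη hη₁ hσ hc in
/-- **`Ĥ` is continuously differentiable.** [folklore] -/
theorem contDiff_Hhat : ContDiff ℝ 1 (Hhat σ c η₀ η₁) := by
  have hsm : ∀ a δ : ℝ, ContDiff ℝ 1 (softMax a δ) := fun a δ => contDiff_softMax a δ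
  have h1 : ContDiff ℝ 1 fun p : CV => softMax (c / 4) (c / 4) p.1 := (hsm _ _).comp contDiff_fst
  have h1ne : ∀ p : CV, softMax (c / 4) (c / 4) p.1 ≠ 0 := fun p => (softMax_density_pos hc p.1).ne'
  have hm : ∀ k : Fin 3, ContDiff ℝ 1 fun p : CV => p.2.1 k := fun k =>
    (contDiff_apply ℝ ℝ k).comp (contDiff_fst.comp contDiff_snd)
  have hθf : ContDiff ℝ 1 fun p : CV => thetaOf (softMax (c / 4) (c / 4) p.1) p.2.2 p.2.1 := by
    unfold thetaOf
    refine contDiff_const.mul (((contDiff_snd.comp contDiff_snd).div h1 h1ne).sub ?_)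
    refine (ContDiff.sum fun k _ => (hm k).pow 2).div (contDiff_const.mul (h1.pow 2)) fun p => ?_
    exact mul_ne_zero two_ne_zero (pow_ne_zero 2 (h1ne p))
  have h2 : ContDiff ℝ 1 fun p : CV => softMax (c / 4) (c / 4) (thetaOf (softMax (c / 4) (c / 4) p.1) p.2.2 p.2.1) :=
    (hsm _ _).comp hθf
  have h2ne : ∀ p : CV, softMax (c / 4) (c / 4) (thetaOf (softMax (c / 4) (c / 4) p.1) p.2.2 p.2.1) ≠ 0 :=
    fun p => (softMax_density_pos hc _).ne'
  have h3 : ContDiff ℝ 1 fun p : CV => (η₁ + η₀) / 2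
      - softMax 0 ((η₀ - η₁) / 6) ((η₁ + η₀) / 2 - softMax (c / 4) (c / 4) p.1 * σ ^ 3) :=
    contDiff_const.sub ((hsm _ _).comp (contDiff_const.sub (h1.mul contDiff_const)))
  have h4 : ContDiff ℝ 1 fun p : CV => hsExcessFreeEnergy ((η₁ + η₀) / 2
      - softMax 0 ((η₀ - η₁) / 6) ((η₁ + η₀) / 2 - softMax (c / 4) (c / 4) p.1 * σ ^ 3)) :=
    (eos_contDiffOn hE).comp_contDiff h3 fun p => clampedEos_mem hη hη₁ hσ hc p.1
  unfold Hhat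
  have h5 : ContDiff ℝ 1 fun p : CV =>
      3 / 2 * Real.log (softMax (c / 4) (c / 4) (thetaOf (softMax (c / 4) (c / 4) p.1) p.2.2 p.2.1)) :=
    contDiff_const.mul (h2.log h2ne)
  exact (h1.mul ((h5.sub (h1.log h1ne)).sub h4)).neg

include hη₁ hc in
/-- On the neighbourhood of the regular range `Ĥ` is the smooth branch of the entropy density. [folklore] -/
theorem Hhat_eq_Hsm {p : CV} (hp : p ∈ regNbhd σ c η₀ η₁) :
    Hhat σ c η₀ η₁ p = Hsm σ p.1 (thetaOf p.1 p.2.2 p.2.1) := by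
  obtain ⟨h1, h2, h3⟩ := hp
  have hc4 : 0 < c / 4 := by positivity
  have hρ : softMax (c / 4) (c / 4) p.1 = p.1 := softMax_eq_self hc4 (by linarith)
  have hθ : softMax (c / 4) (c / 4) (thetaOf p.1 p.2.2 p.2.1) = thetaOf p.1 p.2.2 p.2.1 :=
    softMax_eq_self hc4 (by linarith)
  have hδ : 0 < (η₀ - η₁) / 6 := by linarith
  have hη : softMax 0 ((η₀ - η₁) / 6) ((η₁ + η₀) / 2 - p.1 * σ ^ 3) = (η₁ + η₀) / 2 - p.1 * σ ^ 3 :=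
    softMax_eq_self hδ (by linarith)
  unfold Hhat Hsm
  rw [hρ, hθ, hη, sub_sub_cancel]

include hc in
/-- The neighbourhood of the regular range is open. [folklore] -/
theorem isOpen_regNbhd : IsOpen (regNbhd σ c η₀ η₁) := by
  have hO : IsOpen {p : CV | c / 2 < p.1} := isOpen_lt continuous_const continuous_fst
  have hθc : ContinuousOn (fun p : CV => thetaOf p.1 p.2.2 p.2.1) {p : CV | c / 2 < p.1} := by
    intro p hp
    have hp0 : p.1 ≠ 0 := by have : c / 2 < p.1 := hp; intro h; rw [h] at this; linarith
    refine ContinuousAt.continuousWithinAt ?_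
    unfold thetaOf
    refine continuousAt_const.mul ((continuousAt_snd.comp continuousAt_snd).div continuousAt_fst hp0 |>.sub ?_)
    refine ContinuousAt.div ?_ (continuousAt_const.mul (continuousAt_fst.pow 2)) (by positivity)
    exact (continuous_finsetSum _ fun k _ =>
      ((continuous_apply k).comp (continuous_fst.comp continuous_snd)).pow 2).continuousAt
  have h2 : IsOpen ({p : CV | c / 2 < p.1} ∩ (fun p : CV => thetaOf p.1 p.2.2 p.2.1) ⁻¹' Set.Ioi (c / 2)) :=
    hθc.isOpen_inter_preimage hO isOpen_Ioi
  have h3 : IsOpen {p : CV | p.1 * σ ^ 3 < (2 * η₁ + η₀) / 3} :=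
    isOpen_lt (continuous_fst.mul continuous_const) continuous_const
  have heq : regNbhd σ c η₀ η₁ =
      ({p : CV | c / 2 < p.1} ∩ (fun p : CV => thetaOf p.1 p.2.2 p.2.1) ⁻¹' Set.Ioi (c / 2)) ∩
        {p : CV | p.1 * σ ^ 3 < (2 * η₁ + η₀) / 3} := by
    ext p; simp only [regNbhd, Set.mem_setOf_eq, Set.mem_inter_iff, Set.mem_preimage, Set.mem_Ioi, and_assoc]
  rw [heq]
  exact h2.inter h3

include hη₁ hc in
/-- Regular values of the conserved variables lie in the neighbourhood. [folklore] -/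
theorem mem_regNbhd_of_regular {p : CV} (h1 : c ≤ p.1) (h2 : c ≤ thetaOf p.1 p.2.2 p.2.1) (h3 : p.1 * σ ^ 3 ≤ η₁) :
    p ∈ regNbhd σ c η₀ η₁ :=
  ⟨by linarith, by linarith, by linarith⟩

end Props

/-! ## Joint continuity of smooth space–time fields -/

/-- A space–time field with continuous lift is jointly continuous on `ℝ × 𝕋³`. [folklore] -/
theorem continuous_uncurry_of_stLift {φ : ℝ → T3 → ℝ} (h : Continuous (Torus.stLift φ)) :
    Continuous (Function.uncurry φ) := by
  have hq : IsOpenQuotientMap (Prod.map (id : ℝ → ℝ) (Torus.proj : V3 → T3)) :=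
    ⟨Function.surjective_id.prodMap Torus.proj_surjective, continuous_id.prodMap Torus.continuous_proj,
      IsOpenMap.id.prodMap Torus.isOpenQuotientMap_proj.isOpenMap⟩
  rw [← hq.continuous_comp_iff]
  exact h

/-- A smooth space–time test function is jointly continuous. [folklore] -/
theorem continuous_uncurry_of_smooth {φ : ℝ → T3 → ℝ} (hφ : Torus.IsSmoothSpaceTimeOn Set.univ φ) :
    Continuous (Function.uncurry φ) := by
  refine continuous_uncurry_of_stLift ?_
  have h := hφ.continuousOn_stLift
  rw [Set.univ_prod_univ] at h
  exact continuousOn_univ.1 h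

/-- The time derivative of a smooth space–time test function is jointly continuous. [folklore] -/
theorem continuous_uncurry_deriv_of_smooth {φ : ℝ → T3 → ℝ} (hφ : Torus.IsSmoothSpaceTimeOn Set.univ φ) :
    Continuous (Function.uncurry fun s x => deriv (fun s' => φ s' x) s) := by
  have h := continuous_uncurry_of_smooth (hφ.timeDerivWithin uniqueDiffOn_univ)
  have hfun : (fun s x => deriv (fun s' => φ s' x) s) = Torus.timeDerivWithin Set.univ φ := by
    funext s x; simp [Torus.timeDerivWithin, derivWithin_univ]
  rwa [hfun]

/-- Time slices of a smooth space–time test function are differentiable in time. [folklore] -/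
theorem hasDerivAt_time_slice {φ : ℝ → T3 → ℝ} (hφ : Torus.IsSmoothSpaceTimeOn Set.univ φ) (s : ℝ) (x : T3) :
    HasDerivAt (fun s' => φ s' x) (deriv (fun s' => φ s' x) s) s :=
  ((hφ.hasDerivWithinAt_slice (Set.mem_univ s) x).hasDerivAt Filter.univ_mem).differentiableAt.hasDerivAt

/-- Time slices of a smooth space–time test function are uniformly Lipschitz on compact time intervals.
[folklore] -/
theorem exists_time_lipschitz {φ : ℝ → T3 → ℝ} (hφ : Torus.IsSmoothSpaceTimeOn Set.univ φ) (a b : ℝ) :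
    ∃ M, ∀ x, ∀ s ∈ Set.Icc a b, ∀ s' ∈ Set.Icc a b, |φ s' x - φ s x| ≤ M * |s' - s| := by
  obtain ⟨M, hM⟩ := (hφ.timeDerivWithin uniqueDiffOn_univ).exists_norm_le_of_isCompact isCompact_Icc
    (Set.subset_univ (Set.Icc a b))
  refine ⟨M, fun x s hs s' hs' => ?_⟩
  have h := (convex_Icc a b).norm_image_sub_le_of_norm_hasDerivWithin_le (f := fun τ => φ τ x)
    (fun τ _ => (hφ.hasDerivWithinAt_slice (Set.mem_univ τ) x).mono (Set.subset_univ _))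
    (fun τ hτ => hM τ hτ x) hs hs'
  simpa [Real.norm_eq_abs] using h


/-- Applying a linear functional on the conserved variables componentwise. [folklore] -/
theorem clm_apply_CV (L : CV →L[ℝ] ℝ) (a : ℝ) (b : Fin 3 → ℝ) (e : ℝ) :
    L (a, b, e) = a * L (1, 0, 0) + ∑ l, b l * L (0, Pi.single l 1, 0) + e * L (0, 0, 1) := by
  have h : ((a, b, e) : CV) = a • ((1 : ℝ), (0 : Fin 3 → ℝ), (0 : ℝ))
      + ∑ l, b l • ((0 : ℝ), (Pi.single l (1 : ℝ) : Fin 3 → ℝ), (0 : ℝ)) + e • ((0 : ℝ), (0 : Fin 3 → ℝ), (1 : ℝ)) := by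
    ext
    · simp [Prod.fst_sum]
    · simp [Prod.fst_sum, Prod.snd_sum, Finset.sum_apply, Pi.single_apply]
    · simp [Prod.snd_sum]
  rw [h]
  simp only [map_add, map_sum, map_smul, smul_eq_mul]



end L

/-- **Registered sub-goal `ledgerL_hhat`** of stub `stub_ledger` (line `exact-entropy-ledger-three-passivities`):
The smooth global modification of the entropy density is continuously differentiable. [folklore] -/
theorem ledgerL_hhat :
  ∀ {σ c η₀ η₁ : ℝ} {F : ℝ → ℝ}, EosBand η₀ F → 0 < η₁ → η₁ < η₀ → 0 < σ → 0 < c → ContDiff ℝ 1 (L.Hhat σ c η₀ η₁) :=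
  fun hE hη hη₁ hσ hc => L.contDiff_Hhat hE hη hη₁ hσ hc

end Summit.AtomisticToContinuum.HydrodynamicLimit.Theorems.LocalSecondLawLedger

end
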